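import Mathlib
import Summits.Ventures.PercRepro2.ZMeanProof
import Summits.Ventures.PercRepro2.PocketConn
import Summits.Ventures.PercRepro2.PocketLaw
import Summits.Ventures.PercRepro2.PocketRowPD
import Summits.Ventures.PercRepro2.PocketRowT
import Summits.Ventures.PercRepro2.PocketMasses
import Summits.Ventures.PercRepro2.PocketHMFc
import Summits.Ventures.PercRepro2.PocketTransport
import Summits.Ventures.PercRepro2.PocketBHK

/-!
# The root-only-pocket theorem: (HMF), hence (HCOV), whenever `{a₁, a₂}` separates `a₃` from `{o, b}`

The outside quantities of `PocketHMFc.HMFc_pocket` (outside masses, `Z₁`, the mean-field sums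
`Y_T`, `Y_T′`) are, by the transport lemma `prob_restrict_compl_eq`, ordinary percolation
quantities for the weights `pOut = p` zeroed on the pocket edges (`outMass_eq`, `QOutside_eq`,
`outTermT_eq`, `prob_out_cluster_eq`).  The two brackets of the closed form are then the
mean-field T-row inequality `mfT_le` for `pOut` and its mirror, so `HMF_pocket_of_beta` applies:

**`HMF_pocket` / `HCov_pocket`**: for every root-only pocket `P ∋ a₃` (every edge leaving `P` ends
in `P` or at a root) with `a₁ ≠ a₂`, `a₁, a₂, o, b ∉ P`, `(HMF)` and `(HCOV)` hold.
-/

namespace Summit.Ventures.PercRepro2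

namespace PocketConn

variable {V : Type*} {E : Type*} [Fintype V] [DecidableEq V] [Fintype E] [DecidableEq E]
  {R : Type*} [Field R] [LinearOrder R] [IsStrictOrderedRing R]

variable {ends : E → Sym2 V} {P : Finset V} {a₁ a₂ a₃ : V}

/-- The outside weights: `p` with the pocket edges set to `0`. -/
noncomputable def pOut (p : E → R) (ends : E → Sym2 V) (P : Finset V) : E → R :=
  zeroOn (touches ends (↑P : Set V)).toFinset p

omit [LinearOrder R] [IsStrictOrderedRing R] in
/-- `Z₁ = P_{pOut}(Q)`. -/
lemma QOutside_eq (p : E → R) :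
    prob p (QOutside ends (↑P : Set V) a₁ a₂) = prob (pOut p ends P) (connEvent ends a₁ a₂)ᶜ := by
  have h := prob_restrict_compl_eq (touches ends (↑P : Set V)) p (fun σ => ¬ Conn ends σ a₁ a₂)
  rw [QOutside, h]
  rfl

omit [LinearOrder R] [IsStrictOrderedRing R] in
/-- `A_x¹ = P_{pOut}(Q, x ↔ v)`. -/
lemma outMass_eq (p : E → R) (x v : V) :
    outMass p ends P a₁ a₂ x v =
      prob (pOut p ends P) ((connEvent ends a₁ a₂)ᶜ ∩ connEvent ends x v) := by
  have h := prob_restrict_compl_eq (touches ends (↑P : Set V)) p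
    (fun σ => ¬ Conn ends σ a₁ a₂ ∧ Conn ends σ x v)
  rw [outMass]
  have e : QOutside ends (↑P : Set V) a₁ a₂ ∩
      {ω | Conn ends (restrict (touches ends (↑P : Set V))ᶜ ω) x v} =
      {ω | ¬ Conn ends (restrict (touches ends (↑P : Set V))ᶜ ω) a₁ a₂ ∧
        Conn ends (restrict (touches ends (↑P : Set V))ᶜ ω) x v} := rfl
  rw [e, h]
  rfl

omit [LinearOrder R] [IsStrictOrderedRing R] in
/-- `P(Q₁, C₁(a₂) = W₂) = P_{pOut}(Q, C(a₂) = W₂)`. -/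
lemma prob_out_cluster_eq (p : E → R) (x y s : V) (W₂ : Finset V) :
    prob p {ω | ¬ Conn ends (restrict (touches ends (↑P : Set V))ᶜ ω) x y ∧
        cluster ends (restrict (touches ends (↑P : Set V))ᶜ ω) s = (↑W₂ : Set V)} =
      prob (pOut p ends P) ((connEvent ends x y)ᶜ ∩ clusterEvent ends s (↑W₂ : Set V)) := by
  have h := prob_restrict_compl_eq (touches ends (↑P : Set V)) p
    (fun σ => ¬ Conn ends σ x y ∧ cluster ends σ s = (↑W₂ : Set V))
  rw [h]
  rfl

omit [LinearOrder R] [IsStrictOrderedRing R] in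
/-- `outDelConnProb = delConnProb` for the outside weights. -/
lemma outDelConnProb_eq (p : E → R) (W₂ : Finset V) (x v : V) :
    outDelConnProb p ends P W₂ x v = delConnProb (pOut p ends P) ends W₂ x v := by
  simp only [outDelConnProb, delConnProb]
  by_cases hv : v ∈ W₂
  · rw [if_pos hv, if_pos hv]
  · rw [if_neg hv, if_neg hv]
    have h := prob_restrict_compl_eq (touches ends (↑P : Set V)) p
      (fun σ => Conn ends (restrict (touches ends (↑W₂ : Set V))ᶜ σ) x v)
    rw [h]
    rfl

omit [LinearOrder R] [IsStrictOrderedRing R] in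
/-- `outTermT = termT` for the outside weights. -/
lemma outTermT_eq (p : E → R) (W₂ : Finset V) (o x b : V) :
    outTermT p ends P W₂ o x b = termT (pOut p ends P) ends W₂ o x b := by
  simp only [outTermT, termT, outDelConnProb_eq]

/-- The outside weights form a probability vector. -/
lemma IsProbVec.pOut {p : E → R} (hp : IsProbVec p) : IsProbVec (pOut p ends P) :=
  IsProbVec.zeroOn hp _

/-- **The root-only-pocket theorem, (HMF) form.** -/
theorem HMF_pocket (p : E → R) (hp : IsProbVec p) (hP : IsPocket ends (↑P : Set V) a₁ a₂)
    (h12 : a₁ ≠ a₂) (h1 : a₁ ∉ P) (h2 : a₂ ∉ P) {o b : V} (ho : o ∉ P) (hb : b ∉ P)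
    (h3 : a₃ ∈ P) : HMF p ends o a₁ a₂ a₃ b := by
  have hp' : IsProbVec (pOut p ends P) := IsProbVec.pOut hp
  refine HMF_pocket_of_beta p hp hP h12 h1 h2 ho hb h3 ?_ ?_
  · -- `β₂ ≥ 0`: the T-row inequality for `pOut`
    have key := mfT_le (pOut p ends P) ends hp' o a₁ a₂ b
    rw [QOutside_eq, outMass_eq, outMass_eq, outMass_eq]
    simp_rw [prob_out_cluster_eq, outTermT_eq]
    linarith [key]
  · -- `β₁ ≥ 0`: the mirror inequality
    have key := mfT_le (pOut p ends P) ends hp' o a₂ a₁ b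
    rw [QOutside_eq, outMass_eq, outMass_eq, outMass_eq]
    simp_rw [prob_out_cluster_eq, outTermT_eq]
    rw [connEvent_comm ends a₁ a₂]
    linarith [key]

/-- **The root-only-pocket theorem, (HCOV) form**: `(HCOV)` holds whenever the root pair
`{a₁, a₂}` separates `a₃` from `{o, b}`. -/
theorem HCov_pocket (p : E → R) (hp : IsProbVec p) (hP : IsPocket ends (↑P : Set V) a₁ a₂)
    (h12 : a₁ ≠ a₂) (h1 : a₁ ∉ P) (h2 : a₂ ∉ P) {o b : V} (ho : o ∉ P) (hb : b ∉ P)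
    (h3 : a₃ ∈ P) : CovForm.HCov p ends o a₁ a₂ a₃ b :=
  HCov_of_HMF p hp ends o a₁ a₂ a₃ b (HMF_pocket p hp hP h12 h1 h2 ho hb h3)

end PocketConn

end Summit.Ventures.PercRepro2
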